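import Mathlib.MeasureTheory.Function.JacobianOneDim
import Mathlib.MeasureTheory.Integral.IntegralEqImproper
import Mathlib.Analysis.SpecialFunctions.Pow.Complex
import Literature.NumberTheory.LFunctions.DeBruijnPhiTheta
import Literature.NumberTheory.LFunctions.RiemannXi
import HarnessLib

/-!
# `H_0(z) = ξ(1/2 + iz/2)/8`: Riemann's integral representation of `Ξ` — proof

Trunk T-ANT, `Literature/NumberTheory/LFunctions`; companion ("Proofs") file of `DeBruijnNewman.lean`
discharging the named fact `Literature.NumberTheory.LFunctions.deBruijnH_zero_eq`:

  `H_0(z) = ∫₀^∞ Φ(u) cos(zu) du = ξ(1/2 + iz/2) / 8`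

(Titchmarsh §10.1, (10.1.2)–(10.1.4): `Ξ(t) = 2∫₀^∞ Φ_T(u) cos(ut) du`; Rodgers–Tao 2020, eq. (3), in
whose normalisation `Φ(u) = Φ_T(2u)/2` and `H_0(z) = Ξ(z/2)/8`).

## Proof

Write `M(u) = e^{u}(θ(e^{4u}) − 1)` (`Literature.NumberTheory.LFunctions.deBruijnThetaM`), so that `16 Φ = M'' − M`
(`Literature.NumberTheory.LFunctions.deBruijnThetaM₂_sub_deBruijnThetaM`) and `M'(0) = −1` (`Literature.NumberTheory.LFunctions.deBruijnThetaM₁_zero`), and put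
`J(z) = ∫₀^∞ M(u) cos(zu) du`.

1. (`Literature.NumberTheory.LFunctions.completedRiemannZeta₀_eq_mellin_deBruijnThetaTail`) Mathlib's entire completed zeta function is
   `Λ₀(s) = ½ (𝓜F(s/2) + 𝓜F((1−s)/2))` with `F = 𝟙_{(1,∞)} (θ − 1)`: unfold
   `completedRiemannZeta₀ = mellin f_modif (s/2) / 2` and symmetrise the `(0,1)` piece of
   `WeakFEPair.f_modif` with the theta functional equation (`mellin_comp_inv`, `mellin_cpow_smul`).
2. (`Literature.NumberTheory.LFunctions.mellin_deBruijnThetaTail_eq`) The substitution `x = e^{4u}` gives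
   `𝓜F(w) = 4 ∫₀^∞ e^{(4w−1)u} M(u) du`, whence `𝓜F(s/2) + 𝓜F((1−s)/2) = 8 J(z)` for
   `s = ½ + iz/2` (`Literature.NumberTheory.LFunctions.completedRiemannZeta₀_eq_deBruijnThetaJ`: `Λ₀(s) = 4 J(z)`).
3. (`Literature.integral_deBruijnThetaM₂_mul_cos`) Two integrations by parts on `(0, ∞)`:
   `∫₀^∞ M''(u) cos(zu) du = −M'(0) − z² J(z) = 1 − z² J(z)`.
4. Hence `16 H_0(z) = ∫₀^∞ (M'' − M) cos(zu) = 1 − (1 + z²) J(z) = 1 + s(s−1) Λ₀(s) = 2 ξ(s)`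
   (`Literature.NumberTheory.LFunctions.deBruijnH_zero_eq_holds`).

## References

* E. C. Titchmarsh, *The theory of the Riemann zeta-function*, 2nd ed. (1986), §2.6, §10.1.
* B. Rodgers, T. Tao, *The de Bruijn–Newman constant is non-negative*, Forum Math. Pi 8 (2020),
  §1, eq. (1)–(3).
-/

noncomputable section

open Real Complex Set Filter Topology MeasureTheory HurwitzZeta

namespace Literature.NumberTheory.LFunctions

/-! ## Step 1: `Λ₀(s) = ½ (𝓜F(s/2) + 𝓜F((1−s)/2))`, `F = 𝟙_{(1,∞)} (θ − 1)` -/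

/-- `F(x) = 𝟙_{(1,∞)}(x) (θ(x) − 1)`, `θ = HurwitzZeta.cosKernel 0`. [folklore] -/
def deBruijnThetaTail (x : ℝ) : ℂ :=
  (Ioi (1 : ℝ)).indicator (fun x ↦ ((cosKernel 0 x : ℝ) : ℂ) - 1) x

/-- Mathlib's `f_modif` for the Riemann zeta FE-pair, on `(1, ∞)`. [folklore] -/
theorem f_modif_of_one_lt {x : ℝ} (hx : 1 < x) :
    (hurwitzEvenFEPair 0).f_modif x = ((cosKernel 0 x : ℝ) : ℂ) - 1 := by
  rw [WeakFEPair.f_modif, Pi.add_apply, indicator_of_mem (mem_Ioi.2 hx),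
    indicator_of_notMem (fun h ↦ (notMem_Ioo_of_ge hx.le) h), add_zero]
  simp [hurwitzEvenFEPair, evenKernel_eq_cosKernel_of_zero]

/-- Mathlib's `f_modif` for the Riemann zeta FE-pair, on `(0, 1)`. [folklore] -/
theorem f_modif_of_lt_one {x : ℝ} (hx0 : 0 < x) (hx : x < 1) :
    (hurwitzEvenFEPair 0).f_modif x = ((cosKernel 0 x : ℝ) : ℂ) - ((x ^ (-(1 / 2 : ℝ)) : ℝ) : ℂ) := by
  rw [WeakFEPair.f_modif, Pi.add_apply, indicator_of_notMem (notMem_Ioi.2 hx.le),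
    indicator_of_mem (mem_Ioo.2 ⟨hx0, hx⟩), zero_add]
  simp [hurwitzEvenFEPair, evenKernel_eq_cosKernel_of_zero]

/-- The `(0,1)` piece of `f_modif` is the reflection of `F`:
`f_modif x = x^{-1/2} F(1/x)` for `0 < x < 1` (theta functional equation). [cite: Titchmarsh1986, §2.6] -/
theorem f_modif_eq_deBruijnThetaTail_inv {x : ℝ} (hx0 : 0 < x) (hx : x < 1) :
    (hurwitzEvenFEPair 0).f_modif x = (x : ℂ) ^ (-(1 / 2 : ℂ)) * deBruijnThetaTail x⁻¹ := by
  rw [f_modif_of_lt_one hx0 hx]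
  have hinv : 1 < x⁻¹ := (one_lt_inv₀ hx0).2 hx
  rw [deBruijnThetaTail, indicator_of_mem (mem_Ioi.2 hinv)]
  have hfe := evenKernel_functional_equation (0 : UnitAddCircle) x
  rw [evenKernel_eq_cosKernel_of_zero] at hfe
  have hpow : ((x ^ (-(1 / 2 : ℝ)) : ℝ) : ℂ) = (x : ℂ) ^ (-(1 / 2 : ℂ)) := by
    rw [Complex.ofReal_cpow hx0.le]; norm_num
  rw [hfe, ← hpow, one_div x]
  have : 1 / x ^ (1 / 2 : ℝ) = x ^ (-(1 / 2 : ℝ)) := by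
    rw [Real.rpow_neg hx0.le, one_div]
  rw [this]
  push_cast
  ring

/-- On `(0, ∞)`, `f_modif = F + (x ↦ x^{-1/2} F(1/x))`. [folklore] -/
theorem f_modif_eq_add {x : ℝ} (hx0 : 0 < x) :
    (hurwitzEvenFEPair 0).f_modif x = deBruijnThetaTail x + (x : ℂ) ^ (-(1 / 2 : ℂ)) * deBruijnThetaTail x⁻¹ := by
  rcases lt_trichotomy x 1 with hx | rfl | hx
  · have h0 : deBruijnThetaTail x = 0 := indicator_of_notMem (notMem_Ioi.2 hx.le) _
    rw [f_modif_eq_deBruijnThetaTail_inv hx0 hx, h0, zero_add]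
  · simp [WeakFEPair.f_modif, deBruijnThetaTail]
  · have h1 : deBruijnThetaTail x = ((cosKernel 0 x : ℝ) : ℂ) - 1 := indicator_of_mem (mem_Ioi.2 hx) _
    have h2 : deBruijnThetaTail x⁻¹ = 0 :=
      indicator_of_notMem (notMem_Ioi.2 (inv_le_one_of_one_le₀ hx.le)) _
    rw [f_modif_of_one_lt hx, h1, h2, mul_zero, add_zero]

/-- The Mellin transform of `f_modif` converges everywhere (Mathlib: strong FE-pair). [folklore] -/
theorem mellinConvergent_f_modif (w : ℂ) : MellinConvergent (hurwitzEvenFEPair 0).f_modif w :=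
  ((hurwitzEvenFEPair 0).isStrongFEPair_toStrongFEPair.hasMellin w).1

/-- The Mellin transform of `F` converges everywhere. [folklore] -/
theorem mellinConvergent_deBruijnThetaTail (w : ℂ) : MellinConvergent deBruijnThetaTail w := by
  have h := (mellinConvergent_f_modif w).indicator (measurableSet_Ioi (a := (1 : ℝ)))
  unfold MellinConvergent
  refine (integrableOn_congr_fun (fun x hx ↦ ?_) measurableSet_Ioi).1 h
  by_cases h1 : x ∈ Ioi (1 : ℝ)
  · rw [indicator_of_mem h1, deBruijnThetaTail, indicator_of_mem h1, f_modif_of_one_lt h1]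
  · rw [indicator_of_notMem h1, deBruijnThetaTail, indicator_of_notMem h1, smul_zero]

/-- The Mellin transform of the reflected piece converges everywhere. [folklore] -/
theorem mellinConvergent_deBruijnThetaTail_inv (w : ℂ) :
    MellinConvergent (fun x : ℝ ↦ (x : ℂ) ^ (-(1 / 2 : ℂ)) * deBruijnThetaTail x⁻¹) w := by
  have h := (mellinConvergent_f_modif w).indicator (measurableSet_Ioc (a := (0 : ℝ)) (b := 1))
  unfold MellinConvergent
  refine (integrableOn_congr_fun (fun x (hx : 0 < x) ↦ ?_) measurableSet_Ioi).1 h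
  dsimp only
  by_cases h1 : x < 1
  · rw [indicator_of_mem (mem_Ioc.2 ⟨hx, h1.le⟩), f_modif_eq_deBruijnThetaTail_inv hx h1]
  · have h1 : 1 ≤ x := not_lt.1 h1
    have : deBruijnThetaTail x⁻¹ = 0 := indicator_of_notMem (notMem_Ioi.2 (inv_le_one_of_one_le₀ h1)) _
    rw [this, mul_zero, smul_zero]
    rcases h1.eq_or_lt with rfl | h1
    · simp [WeakFEPair.f_modif]
    · rw [indicator_of_notMem (fun h ↦ (not_le.2 h1) h.2)]

/-- **`Λ₀` symmetrised** (Riemann's second proof of the functional equation; Titchmarsh §2.6):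
`Λ₀(s) = ½ (𝓜F(s/2) + 𝓜F((1 − s)/2))` with `F = 𝟙_{(1,∞)} (θ − 1)`, for *every* `s`.
[cite: Titchmarsh1986, §2.6] -/
theorem completedRiemannZeta₀_eq_mellin_deBruijnThetaTail (s : ℂ) :
    completedRiemannZeta₀ s = (mellin deBruijnThetaTail (s / 2) + mellin deBruijnThetaTail ((1 - s) / 2)) / 2 := by
  rw [← completedHurwitzZetaEven₀_zero, completedHurwitzZetaEven₀, WeakFEPair.Λ₀]
  congr 1
  have h1 : mellin (hurwitzEvenFEPair 0).f_modif (s / 2) =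
      mellin (fun x ↦ deBruijnThetaTail x + (x : ℂ) ^ (-(1 / 2 : ℂ)) * deBruijnThetaTail x⁻¹) (s / 2) :=
    setIntegral_congr_fun measurableSet_Ioi fun x hx ↦ by simp only [f_modif_eq_add hx]
  rw [h1, (hasMellin_add (mellinConvergent_deBruijnThetaTail _) (mellinConvergent_deBruijnThetaTail_inv _)).2]
  congr 1
  have h2 : mellin (fun x : ℝ ↦ (x : ℂ) ^ (-(1 / 2 : ℂ)) * deBruijnThetaTail x⁻¹) (s / 2) =
      mellin (fun x : ℝ ↦ deBruijnThetaTail x⁻¹) (s / 2 + -(1 / 2 : ℂ)) := by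
    rw [← mellin_cpow_smul]; rfl
  rw [h2, mellin_comp_inv]
  congr 1
  ring

/-! ## Step 2: the substitution `x = e^{4u}` -/

/-- `J(z) = ∫₀^∞ M(u) cos(zu) du`. [folklore] -/
def deBruijnThetaJ (z : ℂ) : ℂ := ∫ u in Ioi (0 : ℝ), (deBruijnThetaM u : ℂ) * Complex.cos (z * u)

/-- `exp(4·)` maps `(0, ∞)` onto `(1, ∞)`. [folklore] -/
theorem image_exp_four_mul_Ioi : (fun u : ℝ ↦ rexp (4 * u)) '' Ioi 0 = Ioi 1 := by
  ext y
  constructor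
  · rintro ⟨u, hu, rfl⟩
    exact Real.one_lt_exp_iff.2 (by simpa using hu)
  · intro hy
    refine ⟨Real.log y / 4, ?_, ?_⟩
    · have := Real.log_pos hy; simp only [mem_Ioi]; linarith
    · show rexp (4 * (Real.log y / 4)) = y
      rw [mul_div_cancel₀ _ (four_ne_zero), Real.exp_log (lt_trans one_pos hy)]

/-- `θ(e^{4u}) − 1 = e^{−u} M(u)`. [folklore] -/
theorem cosKernel_exp_sub_one (u : ℝ) : cosKernel 0 (rexp (4 * u)) - 1 = rexp (-u) * deBruijnThetaM u := by
  rw [deBruijnThetaM_eq, deBruijnThetaK, mul_sub, ← mul_assoc, ← Real.exp_add]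
  simp

/-- **Substitution** `x = e^{4u}`: `𝓜F(w) = ∫₀^∞ 4 e^{(4w−1)u} M(u) du`. [cite: Titchmarsh1986, §10.1] -/
theorem mellin_deBruijnThetaTail_eq (w : ℂ) :
    mellin deBruijnThetaTail w = ∫ u in Ioi (0 : ℝ), 4 * cexp ((4 * w - 1) * u) * (deBruijnThetaM u : ℂ) := by
  -- restrict the Mellin integral to `(1, ∞)`
  have h1 : mellin deBruijnThetaTail w =
      ∫ x in Ioi (1 : ℝ), (x : ℂ) ^ (w - 1) * (((cosKernel 0 x : ℝ) : ℂ) - 1) := by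
    rw [mellin]
    have : (fun x : ℝ ↦ (x : ℂ) ^ (w - 1) • deBruijnThetaTail x) =
        (Ioi (1 : ℝ)).indicator (fun x ↦ (x : ℂ) ^ (w - 1) * (((cosKernel 0 x : ℝ) : ℂ) - 1)) := by
      funext x
      simp only [deBruijnThetaTail, smul_eq_mul, Set.indicator_apply]
      split_ifs <;> simp
    have hI : Ioi (0 : ℝ) ∩ Ioi 1 = Ioi 1 :=
      inter_eq_right.2 (Ioi_subset_Ioi zero_le_one)
    rw [this, setIntegral_indicator measurableSet_Ioi, hI]
  -- change variables
  have hderiv : ∀ u ∈ Ioi (0 : ℝ), HasDerivWithinAt (fun u : ℝ ↦ rexp (4 * u)) (rexp (4 * u) * 4)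
      (Ioi 0) u := fun u _ ↦ by
    simpa using (((hasDerivAt_id u).const_mul 4).exp).hasDerivWithinAt
  have hinj : InjOn (fun u : ℝ ↦ rexp (4 * u)) (Ioi 0) := fun a _ b _ h ↦ by
    simpa using Real.exp_injective h
  have h2 := integral_image_eq_integral_abs_deriv_smul measurableSet_Ioi hderiv hinj
    (fun x : ℝ ↦ (x : ℂ) ^ (w - 1) * (((cosKernel 0 x : ℝ) : ℂ) - 1))
  rw [image_exp_four_mul_Ioi] at h2
  rw [h1, h2]
  refine setIntegral_congr_fun measurableSet_Ioi fun u _ ↦ ?_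
  have hpos : 0 < rexp (4 * u) := Real.exp_pos _
  have hc : ((cosKernel 0 (rexp (4 * u)) : ℝ) : ℂ) - 1 = ((rexp (-u) * deBruijnThetaM u : ℝ) : ℂ) := by
    rw [← cosKernel_exp_sub_one]; push_cast; ring
  rw [abs_of_pos (by positivity), hc, Complex.real_smul,
    Complex.cpow_def_of_ne_zero (Complex.ofReal_ne_zero.2 hpos.ne'),
    ← Complex.ofReal_log hpos.le, Real.log_exp]
  push_cast
  have key : cexp (4 * u) * cexp (4 * u * (w - 1)) * cexp (-u) = cexp ((4 * w - 1) * u) := by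
    rw [← Complex.exp_add, ← Complex.exp_add]
    congr 1
    ring
  linear_combination (4 * (deBruijnThetaM u : ℂ)) * key

/-- Integrability on `(0, ∞)` of `e^{cu} M^{(k)}(u)`-type products: if `|g(u)| ≤ C e^{9u − π e^{4u}}`
on `u ≥ 0`, `g` continuous, and `‖h(u)‖ ≤ e^{Y u}` on `u ≥ 0`, `h` continuous, then `g · h` is
integrable on `(0, ∞)`. [folklore] -/
theorem integrableOn_of_deBruijnThetaBound {g : ℝ → ℝ} {h : ℝ → ℂ} {C B Y : ℝ} (hg : Continuous g)
    (hh : Continuous h) (hgC : ∀ u, 0 ≤ u → |g u| ≤ C * rexp (9 * u - π * rexp (4 * u)))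
    (hhY : ∀ u, 0 ≤ u → ‖h u‖ ≤ B * rexp (Y * u)) :
    IntegrableOn (fun u : ℝ ↦ (g u : ℂ) * h u) (Ioi 0) := by
  have hint := (integrableOn_exp_mul_sub_pi_exp (9 + Y)).const_mul (|C| * |B|)
  refine hint.mono' ((Complex.continuous_ofReal.comp hg).mul hh).aestronglyMeasurable
    (ae_restrict_of_forall_mem measurableSet_Ioi fun u (hu : 0 < u) ↦ ?_)
  rw [norm_mul, Complex.norm_real, Real.norm_eq_abs]
  have hC : C * rexp (9 * u - π * rexp (4 * u)) ≤ |C| * rexp (9 * u - π * rexp (4 * u)) :=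
    mul_le_mul_of_nonneg_right (le_abs_self C) (Real.exp_pos _).le
  have hB : B * rexp (Y * u) ≤ |B| * rexp (Y * u) :=
    mul_le_mul_of_nonneg_right (le_abs_self B) (Real.exp_pos _).le
  calc |g u| * ‖h u‖ ≤ |C| * rexp (9 * u - π * rexp (4 * u)) * (|B| * rexp (Y * u)) :=
        mul_le_mul ((hgC u hu.le).trans hC) ((hhY u hu.le).trans hB) (norm_nonneg _) (by positivity)
    _ = |C| * |B| * rexp ((9 + Y) * u - π * rexp (4 * u)) := by
        rw [mul_mul_mul_comm, ← Real.exp_add]; ring_nf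

/-- `‖exp(a u)‖ ≤ e^{‖a‖ u}` for `u ≥ 0`. [folklore] -/
theorem norm_cexp_mul_real_le (a : ℂ) {u : ℝ} (hu : 0 ≤ u) : ‖cexp (a * u)‖ ≤ rexp (‖a‖ * u) := by
  rw [Complex.norm_exp]
  refine Real.exp_monotone ?_
  have : (a * u).re = a.re * u := by simp
  rw [this]
  exact mul_le_mul_of_nonneg_right (Complex.re_le_norm a) hu

/-- `u ↦ 4 e^{a u} M(u)` is integrable on `(0, ∞)`. [folklore] -/
theorem integrableOn_cexp_mul_deBruijnThetaM (a : ℂ) :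
    IntegrableOn (fun u : ℝ ↦ 4 * cexp (a * u) * (deBruijnThetaM u : ℂ)) (Ioi 0) := by
  obtain ⟨C, hC⟩ := exists_deBruijnThetaM_bound
  have h := integrableOn_of_deBruijnThetaBound (g := deBruijnThetaM) (h := fun u : ℝ ↦ 4 * cexp (a * u))
    (C := C) (B := 4) (Y := ‖a‖) differentiable_deBruijnThetaM.continuous (by fun_prop)
    (fun u hu ↦ (hC u hu).1) fun u hu ↦ ?_
  · refine (integrableOn_congr_fun (fun u _ ↦ ?_) measurableSet_Ioi).1 h
    ring
  · rw [norm_mul, Complex.norm_ofNat]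
    exact mul_le_mul_of_nonneg_left (norm_cexp_mul_real_le a hu) (by norm_num)

/-- **`Λ₀(s) = 4 J(z)`** for `s = ½ + iz/2`: `𝓜F(s/2) + 𝓜F((1−s)/2) = ∫₀^∞ 4 (e^{izu} + e^{−izu}) M(u) du
= 8 J(z)`. [cite: Titchmarsh1986, §10.1] -/
theorem completedRiemannZeta₀_eq_deBruijnThetaJ (z : ℂ) :
    completedRiemannZeta₀ (1 / 2 + I * z / 2) = 4 * deBruijnThetaJ z := by
  rw [completedRiemannZeta₀_eq_mellin_deBruijnThetaTail, mellin_deBruijnThetaTail_eq, mellin_deBruijnThetaTail_eq]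
  have ha : (4 * ((1 / 2 + I * z / 2) / 2) - 1 : ℂ) = I * z := by ring
  have hb : (4 * ((1 - (1 / 2 + I * z / 2)) / 2) - 1 : ℂ) = -(I * z) := by ring
  rw [ha, hb, ← integral_add (integrableOn_cexp_mul_deBruijnThetaM _) (integrableOn_cexp_mul_deBruijnThetaM _),
    deBruijnThetaJ, ← integral_div]
  simp_rw [← integral_const_mul]
  refine setIntegral_congr_fun measurableSet_Ioi fun u _ ↦ ?_
  rw [Complex.cos, neg_mul]
  ring_nf

/-! ## Step 3: two integrations by parts on `(0, ∞)` -/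

/-- `d/du cos(zu) = −z sin(zu)` (real variable `u`). [folklore] -/
theorem hasDerivAt_cos_mul_real (z : ℂ) (u : ℝ) :
    HasDerivAt (fun x : ℝ ↦ Complex.cos (z * x)) (-(z * Complex.sin (z * u))) u := by
  have h : HasDerivAt (fun w : ℂ ↦ Complex.cos (z * w)) (-Complex.sin (z * u) * (z * 1)) (u : ℂ) :=
    ((hasDerivAt_id (u : ℂ)).const_mul z).ccos
  refine (h.comp_ofReal).congr_deriv ?_
  ring

/-- `d/du sin(zu) = z cos(zu)` (real variable `u`). [folklore] -/
theorem hasDerivAt_sin_mul_real (z : ℂ) (u : ℝ) :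
    HasDerivAt (fun x : ℝ ↦ Complex.sin (z * x)) (z * Complex.cos (z * u)) u := by
  have h : HasDerivAt (fun w : ℂ ↦ Complex.sin (z * w)) (Complex.cos (z * u) * (z * 1)) (u : ℂ) :=
    ((hasDerivAt_id (u : ℂ)).const_mul z).csin
  refine (h.comp_ofReal).congr_deriv ?_
  ring

/-- `‖cos(zu)‖ ≤ e^{‖z‖ u}` for `u ≥ 0`. [folklore] -/
theorem norm_cos_mul_real_le (z : ℂ) {u : ℝ} (hu : 0 ≤ u) :
    ‖Complex.cos (z * u)‖ ≤ rexp (‖z‖ * u) := by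
  rw [Complex.cos]
  have h1 := norm_cexp_mul_real_le (z * I) hu
  have h2 := norm_cexp_mul_real_le (-(z * I)) hu
  rw [norm_neg] at h2
  rw [norm_mul, Complex.norm_I, mul_one] at h1 h2
  rw [norm_div, Complex.norm_two]
  have := norm_add_le (cexp (z * I * u)) (cexp (-(z * I) * u))
  have e1 : cexp (z * u * I) = cexp (z * I * u) := by ring_nf
  have e2 : cexp (-(z * u) * I) = cexp (-(z * I) * u) := by ring_nf
  rw [e1, e2]
  linarith

/-- `‖sin(zu)‖ ≤ e^{‖z‖ u}` for `u ≥ 0`. [folklore] -/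
theorem norm_sin_mul_real_le (z : ℂ) {u : ℝ} (hu : 0 ≤ u) :
    ‖Complex.sin (z * u)‖ ≤ rexp (‖z‖ * u) := by
  rw [Complex.sin]
  have h1 := norm_cexp_mul_real_le (z * I) hu
  have h2 := norm_cexp_mul_real_le (-(z * I)) hu
  rw [norm_neg] at h2
  rw [norm_mul, Complex.norm_I, mul_one] at h1 h2
  rw [norm_div, norm_mul, Complex.norm_two, Complex.norm_I, mul_one]
  have := norm_sub_le (cexp (-(z * I) * u)) (cexp (z * I * u))
  have e1 : cexp (z * u * I) = cexp (z * I * u) := by ring_nf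
  have e2 : cexp (-(z * u) * I) = cexp (-(z * I) * u) := by ring_nf
  rw [e1, e2]
  linarith

/-- A product `g(u) h(u)` with `|g| ≤ C e^{9u − π e^{4u}}` and `‖h‖ ≤ e^{Yu}` tends to `0` at `+∞`.
[folklore] -/
theorem tendsto_zero_of_deBruijnThetaBound {g : ℝ → ℝ} {h : ℝ → ℂ} {C B Y : ℝ}
    (hgC : ∀ u, 0 ≤ u → |g u| ≤ C * rexp (9 * u - π * rexp (4 * u)))
    (hhY : ∀ u, 0 ≤ u → ‖h u‖ ≤ B * rexp (Y * u)) :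
    Tendsto (fun u : ℝ ↦ (g u : ℂ) * h u) atTop (𝓝 0) := by
  have hlim : Tendsto (fun u : ℝ ↦ |C| * |B| * rexp ((9 + Y) * u - π * rexp (4 * u)))
      atTop (𝓝 0) := by
    simpa using (tendsto_exp_mul_sub_pi_exp (9 + Y)).const_mul (|C| * |B|)
  refine squeeze_zero_norm' ?_ hlim
  filter_upwards [eventually_ge_atTop 0] with u hu
  rw [norm_mul, Complex.norm_real, Real.norm_eq_abs]
  have hC : C * rexp (9 * u - π * rexp (4 * u)) ≤ |C| * rexp (9 * u - π * rexp (4 * u)) :=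
    mul_le_mul_of_nonneg_right (le_abs_self C) (Real.exp_pos _).le
  have hB : B * rexp (Y * u) ≤ |B| * rexp (Y * u) :=
    mul_le_mul_of_nonneg_right (le_abs_self B) (Real.exp_pos _).le
  calc |g u| * ‖h u‖ ≤ |C| * rexp (9 * u - π * rexp (4 * u)) * (|B| * rexp (Y * u)) :=
        mul_le_mul ((hgC u hu).trans hC) ((hhY u hu).trans hB) (norm_nonneg _) (by positivity)
    _ = |C| * |B| * rexp ((9 + Y) * u - π * rexp (4 * u)) := by
        rw [mul_mul_mul_comm, ← Real.exp_add]; ring_nf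

/-- First integration by parts: `∫₀^∞ sin(zu) M'(u) du = −z J(z)` (boundary terms vanish:
`sin 0 = 0`, super-exponential decay at `∞`). [cite: Titchmarsh1986, §10.1] -/
theorem integral_sin_mul_deBruijnThetaM₁ (z : ℂ) :
    ∫ u in Ioi (0 : ℝ), Complex.sin (z * u) * (deBruijnThetaM₁ u : ℂ) = -(z * deBruijnThetaJ z) := by
  obtain ⟨C, hC⟩ := exists_deBruijnThetaM_bound
  have hIBP := integral_Ioi_mul_deriv_eq_deriv_mul (a := 0)
    (u := fun x : ℝ ↦ Complex.sin (z * x)) (u' := fun x : ℝ ↦ z * Complex.cos (z * x))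
    (v := fun x : ℝ ↦ (deBruijnThetaM x : ℂ)) (v' := fun x : ℝ ↦ (deBruijnThetaM₁ x : ℂ)) (a' := 0) (b' := 0)
    (fun x _ ↦ hasDerivAt_sin_mul_real z x) (fun x _ ↦ (hasDerivAt_deBruijnThetaM x).ofReal_comp)
    ?_ ?_ ?_ ?_
  · rw [hIBP, deBruijnThetaJ, sub_zero, zero_sub, ← integral_neg, ← integral_const_mul, ← integral_neg]
    refine setIntegral_congr_fun measurableSet_Ioi fun u _ ↦ ?_
    ring
  · have := integrableOn_of_deBruijnThetaBound (h := fun x : ℝ ↦ Complex.sin (z * x)) (B := 1) (Y := ‖z‖)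
      differentiable_deBruijnThetaM₁.continuous (by fun_prop) (fun u hu ↦ (hC u hu).2.1)
      fun u hu ↦ by rw [one_mul]; exact norm_sin_mul_real_le z hu
    exact (integrableOn_congr_fun (fun u _ ↦ by simp only [Pi.mul_apply]; ring) measurableSet_Ioi).1 this
  · have := integrableOn_of_deBruijnThetaBound (h := fun x : ℝ ↦ z * Complex.cos (z * x)) (B := ‖z‖)
      (Y := ‖z‖) differentiable_deBruijnThetaM.continuous (by fun_prop) (fun u hu ↦ (hC u hu).1)
      fun u hu ↦ by rw [norm_mul]; exact mul_le_mul_of_nonneg_left (norm_cos_mul_real_le z hu) (norm_nonneg _)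
    exact (integrableOn_congr_fun (fun u _ ↦ by simp only [Pi.mul_apply]; ring)
      measurableSet_Ioi).1 this
  · have hc : ContinuousAt (fun x : ℝ ↦ Complex.sin (z * x) * (deBruijnThetaM x : ℂ)) 0 :=
      ((by fun_prop : Continuous fun x : ℝ ↦ Complex.sin (z * x)).mul
        (Complex.continuous_ofReal.comp differentiable_deBruijnThetaM.continuous)).continuousAt
    have := hc.tendsto
    simp only [Complex.ofReal_zero, mul_zero, Complex.sin_zero, zero_mul] at this
    exact this.mono_left nhdsWithin_le_nhds
  · have := tendsto_zero_of_deBruijnThetaBound (h := fun x : ℝ ↦ Complex.sin (z * x)) (B := 1) (Y := ‖z‖)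
      (fun u hu ↦ (hC u hu).1) fun u hu ↦ by rw [one_mul]; exact norm_sin_mul_real_le z hu
    refine this.congr fun u ↦ ?_
    simp only [Pi.mul_apply]; ring

/-- Second integration by parts: `∫₀^∞ cos(zu) M''(u) du = −M'(0) − z² J(z) = 1 − z² J(z)`.
[cite: Titchmarsh1986, §10.1] -/
theorem integral_cos_mul_deBruijnThetaM₂ (z : ℂ) :
    ∫ u in Ioi (0 : ℝ), Complex.cos (z * u) * (deBruijnThetaM₂ u : ℂ) = 1 - z ^ 2 * deBruijnThetaJ z := by
  obtain ⟨C, hC⟩ := exists_deBruijnThetaM_bound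
  have hIBP := integral_Ioi_mul_deriv_eq_deriv_mul (a := 0)
    (u := fun x : ℝ ↦ Complex.cos (z * x)) (u' := fun x : ℝ ↦ -(z * Complex.sin (z * x)))
    (v := fun x : ℝ ↦ (deBruijnThetaM₁ x : ℂ)) (v' := fun x : ℝ ↦ (deBruijnThetaM₂ x : ℂ)) (a' := -1) (b' := 0)
    (fun x _ ↦ hasDerivAt_cos_mul_real z x) (fun x _ ↦ (hasDerivAt_deBruijnThetaM₁ x).ofReal_comp)
    ?_ ?_ ?_ ?_
  · rw [hIBP]
    have : ∫ x in Ioi (0 : ℝ), -(z * Complex.sin (z * x)) * (deBruijnThetaM₁ x : ℂ) =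
        -(z * ∫ x in Ioi (0 : ℝ), Complex.sin (z * x) * (deBruijnThetaM₁ x : ℂ)) := by
      rw [← integral_const_mul, ← integral_neg]
      refine setIntegral_congr_fun measurableSet_Ioi fun u _ ↦ ?_
      ring
    rw [this, integral_sin_mul_deBruijnThetaM₁]
    ring
  · have := integrableOn_of_deBruijnThetaBound (h := fun x : ℝ ↦ Complex.cos (z * x)) (B := 1) (Y := ‖z‖)
      continuous_deBruijnThetaM₂ (by fun_prop) (fun u hu ↦ (hC u hu).2.2)
      fun u hu ↦ by rw [one_mul]; exact norm_cos_mul_real_le z hu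
    exact (integrableOn_congr_fun (fun u _ ↦ by simp only [Pi.mul_apply]; ring) measurableSet_Ioi).1 this
  · have := integrableOn_of_deBruijnThetaBound (h := fun x : ℝ ↦ -(z * Complex.sin (z * x))) (B := ‖z‖)
      (Y := ‖z‖) differentiable_deBruijnThetaM₁.continuous (by fun_prop) (fun u hu ↦ (hC u hu).2.1)
      fun u hu ↦ by
        rw [norm_neg, norm_mul]
        exact mul_le_mul_of_nonneg_left (norm_sin_mul_real_le z hu) (norm_nonneg _)
    exact (integrableOn_congr_fun (fun u _ ↦ by simp only [Pi.mul_apply]; ring)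
      measurableSet_Ioi).1 this
  · have hc : ContinuousAt (fun x : ℝ ↦ Complex.cos (z * x) * (deBruijnThetaM₁ x : ℂ)) 0 :=
      ((by fun_prop : Continuous fun x : ℝ ↦ Complex.cos (z * x)).mul
        (Complex.continuous_ofReal.comp differentiable_deBruijnThetaM₁.continuous)).continuousAt
    have := hc.tendsto
    simp only [Complex.ofReal_zero, mul_zero, Complex.cos_zero, one_mul, deBruijnThetaM₁_zero] at this
    push_cast at this
    exact this.mono_left nhdsWithin_le_nhds
  · have := tendsto_zero_of_deBruijnThetaBound (h := fun x : ℝ ↦ Complex.cos (z * x)) (B := 1) (Y := ‖z‖)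
      (fun u hu ↦ (hC u hu).2.1) fun u hu ↦ by rw [one_mul]; exact norm_cos_mul_real_le z hu
    refine this.congr fun u ↦ ?_
    simp only [Pi.mul_apply]; ring

/-! ## Step 4: assembly -/

/-- `16 H_0(z) = ∫₀^∞ (M'' − M)(u) cos(zu) du = 1 − (1 + z²) J(z)`. [cite: Titchmarsh1986, §10.1] -/
theorem sixteen_mul_deBruijnH_zero (z : ℂ) : 16 * deBruijnH 0 z = 1 - (1 + z ^ 2) * deBruijnThetaJ z := by
  obtain ⟨C, hC⟩ := exists_deBruijnThetaM_bound
  have hM : IntegrableOn (fun u : ℝ ↦ (deBruijnThetaM u : ℂ) * Complex.cos (z * u)) (Ioi 0) :=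
    integrableOn_of_deBruijnThetaBound (B := 1) differentiable_deBruijnThetaM.continuous (by fun_prop)
      (fun u hu ↦ (hC u hu).1) fun u hu ↦ by rw [one_mul]; exact norm_cos_mul_real_le z hu
  have hM₂ : IntegrableOn (fun u : ℝ ↦ (deBruijnThetaM₂ u : ℂ) * Complex.cos (z * u)) (Ioi 0) :=
    integrableOn_of_deBruijnThetaBound (B := 1) continuous_deBruijnThetaM₂ (by fun_prop)
      (fun u hu ↦ (hC u hu).2.2) fun u hu ↦ by rw [one_mul]; exact norm_cos_mul_real_le z hu
  have h1 : 16 * deBruijnH 0 z =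
      ∫ u in Ioi (0 : ℝ), ((deBruijnThetaM₂ u : ℂ) * Complex.cos (z * u) - (deBruijnThetaM u : ℂ) * Complex.cos (z * u)) := by
    rw [deBruijnH, ← integral_const_mul]
    refine setIntegral_congr_fun measurableSet_Ioi fun u _ ↦ ?_
    have := deBruijnThetaM₂_sub_deBruijnThetaM u
    simp only [zero_mul, Real.exp_zero]
    rw [← sub_mul, ← Complex.ofReal_sub, this]
    push_cast
    ring
  rw [h1, integral_sub hM₂ hM]
  have h2 : ∫ u in Ioi (0 : ℝ), (deBruijnThetaM₂ u : ℂ) * Complex.cos (z * u) = 1 - z ^ 2 * deBruijnThetaJ z := by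
    rw [← integral_cos_mul_deBruijnThetaM₂]
    exact setIntegral_congr_fun measurableSet_Ioi fun u _ ↦ mul_comm _ _
  rw [h2, ← deBruijnThetaJ]
  ring

/-- **Discharge** of `Literature.NumberTheory.LFunctions.deBruijnH_zero_eq`: `H_0(z) = ξ(1/2 + iz/2)/8` for every complex `z`
(Titchmarsh §10.1, (10.1.2)–(10.1.4); Rodgers–Tao 2020, eq. (3)). [cite: Titchmarsh1986, §10.1] -/
theorem deBruijnH_zero_eq_holds : deBruijnH_zero_eq := by
  intro z
  have h16 := sixteen_mul_deBruijnH_zero z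
  rw [riemannXi, completedRiemannZeta₀_eq_deBruijnThetaJ]
  have hs : (1 / 2 + I * z / 2) * (1 / 2 + I * z / 2 - 1) / 2 * (4 * deBruijnThetaJ z) =
      -(1 + z ^ 2) * deBruijnThetaJ z / 2 := by
    have hI : I ^ 2 = -1 := Complex.I_sq
    ring_nf
    rw [hI]
    ring
  rw [hs]
  linear_combination h16 / 16

end Literature.NumberTheory.LFunctions

end
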